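import Literature.Probability.RandomPlanarGeometry.TwistedLaceExpansion
import HarnessLib

/-!
# The twisted lace expansion, II: the twisted NoBLE identity

Topic `Literature/Probability/RandomPlanarGeometry`, sequel to `TwistedLaceCoefficient.lean`
(`G^σ_n = twistedTwoPoint`, `Π^σ_m = twistedLaceCoefficient`, `T_σ = twistedStepMatrix`) and
`TwistedLaceExpansion.lean` (gluing and the factorisation `sum_nbWalkFun_mul_K`).

## The statement

**The twisted lace expansion** (`twistedTwoPoint_succ_apply`, matrix form `twistedTwoPoint_succ`):
for every `n ≥ 0`, `z ∈ ℤ²` and spin `σ`,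
`G^σ_{n+1}(z) = Σ_λ T_σ(·,λ) G^σ_n(z - e_λ)(λ,·) + Σ_{m=1}^{n+1} Σ_{y ∈ {-m,…,m}²} Π^σ_m(y) G^σ_{n+1-m}(z - y)`,
with `4 × 4` matrix products, the EARLIER piece of the walk on the LEFT. This is Slade's (3.14),
`c_{n+1} = |Ω|D ∗ cₙ + Σ_{m=1}^{n+1} π_m ∗ c_{n+1-m}`, derived exactly as in §3.2 — (3.12), Lemma 3.4
at `[0, n+1]`, and the two factorisations "first step" / "at time `m`" — for the complex memory-2
(parafermionic, Duminil-Copin–Smirnov) weight `e^{-iσW}` on the non-backtracking reference walk,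
whose multiplicativity holds only after labelling by the incoming direction at `0` and the last
step: the matrix structure of the non-backtracking lace expansion of Fitzner–van der Hofstad
((1.24)–(1.25), there for real weights in high dimensions). As formal power series in the length
variable `x` it reads `Ĝ = E + x D ⋆ Ĝ + Π̂^σ ⋆ Ĝ`, i.e. `Ĝ = (E - xD - Π̂^σ)⁻¹`: the twisted
self-energy `Π^σ = Σ_N (-1)^N Π^{σ,(N)}` (`twistedLaceCoefficient_eq_sum`) is the kernel of the
resolvent identity of route `SAWTwistedSelfEnergy` in its first-step form.

## Contents (namespace `Literature.Probability.RandomPlanarGeometry.LaceExpansion`)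

`twistedTwoPoint_zero_apply` (`G_0 = δ I`), `K_zero_one_eq_one`, `K_self_eq_one`,
`sum_mul_twistedTwoPoint_zero` (convolution with `G_0`), the three pieces
`sum_nbWalkFun_K_one` (first step: `Σ_ω e^{-iσW} K[1,n+1] = Σ_λ T_σ(ι,λ) G_n(z - e_λ)(λ,κ)`),
`sum_nbWalkFun_J_mul_K` (`Σ_ω e^{-iσW} J[0,m] K[m,n+1] = Σ_y (Π_m(y) G_{n+1-m}(z-y))(ι,κ)`, `m ≤ n`),
`sum_nbWalkFun_J_self` (the term `m = n + 1`), the identity `twistedTwoPoint_succ_apply`,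
`twistedTwoPoint_succ`, and the bridge `twistedTwoPoint_eq_sum_paths` (`G^σ_n` as the sum over
self-avoiding Mathlib walks `p : 0 → z`, `p.IsPath`, weights read off `p.getVert`/`p.support` — the
form in which route `SAWTwistedSelfEnergy` writes its two-point matrix).
-/

noncomputable section

open Finset Literature.Probability.LatticeModels Literature.Probability.RandomPlanarGeometry.SAW.Zd
open scoped BigOperators

namespace Literature.Probability.RandomPlanarGeometry.LaceExpansion

/-! ### `G_0`, `K[0,1]`, `K[a,a]` -/

/-- `G^σ_0(w)(λ,κ) = δ_{w,0} δ_{λ,κ}`. [folklore] -/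
theorem twistedTwoPoint_zero_apply (σ : ℝ) (w : Site 2) (l κ : Fin 4) :
    twistedTwoPoint σ 0 w l κ = if w = 0 ∧ l = κ then 1 else 0 := by
  rw [twistedTwoPoint, Matrix.of_apply, if_pos rfl]

/-- `G^σ_1` as the bare walk sum `Σ_ω e^{-iσW} K[0,1]`. [folklore] -/
theorem twistedTwoPoint_one_eq_sum (σ : ℝ) (y : Site 2) (ι l : Fin 4) :
    twistedTwoPoint σ 1 y ι l =
      ∑ ω ∈ nbWalkFun ι l 1 y, twistedWeight σ ι 1 ω * ((K (interaction 1 ω) 0 1 : ℝ) : ℂ) := by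
  rw [twistedTwoPoint, Matrix.of_apply, if_neg one_ne_zero]

/-- `K[0,1](ω) = 1 + U_{01}(ω) = 1` for a walk (`ω(0) ≠ ω(1)`). [cite: Slade2006LaceExpansion, §3.3 (`𝒰_{01} = 0`)] -/
theorem K_zero_one_eq_one {N : ℕ} (hN : 1 ≤ N) {x : Site 2} {ω : ℕ → Site 2}
    (hω : ω ∈ walkFun 2 N x) : K (interaction 1 ω) 0 1 = 1 := by
  obtain ⟨-, -, hadj⟩ := mem_walkFun.1 hω
  have hne : ω 0 ≠ ω 1 := (zdGraph 2).ne_of_adj (hadj 0 hN)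
  rw [K]
  refine Finset.prod_eq_one fun e he => ?_
  rw [mem_edges] at he
  have h1 : e.1 = 0 := by omega
  have h2 : e.2 = 1 := by omega
  rw [interaction, h1, h2, if_neg hne]
  ring

/-- `K[a,a] = 1` (empty product). [cite: Slade2006LaceExpansion, eq. (3.7) (`K[a,a] = 1`)] -/
theorem K_self_eq_one (𝒰 : ℕ → ℕ → ℝ) (a : ℕ) : K 𝒰 a a = 1 := by
  rw [K]
  refine Finset.prod_eq_one fun e he => ?_
  rw [mem_edges] at he
  omega

/-- `e_λ ∈ {-1,0,1}²`. [folklore] -/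
theorem stepDir_mem_box_one (l : Fin 4) : stepDir l ∈ box 2 1 := by
  rw [mem_box]
  intro i
  fin_cases l <;> fin_cases i <;> simp [stepDir]

/-- Convolution with `G_0 = δ I` evaluates at `z` (and vanishes if `z` is outside the summation
box). [folklore] -/
theorem sum_mul_twistedTwoPoint_zero (σ : ℝ) (A : Site 2 → Matrix (Fin 4) (Fin 4) ℂ) (m : ℕ)
    (z : Site 2) (ι κ : Fin 4) :
    ∑ y ∈ box 2 m, ∑ lam : Fin 4, A y ι lam * twistedTwoPoint σ 0 (z - y) lam κ =
      if z ∈ box 2 m then A z ι κ else 0 := by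
  have inner : ∀ y, ∑ lam : Fin 4, A y ι lam * twistedTwoPoint σ 0 (z - y) lam κ =
      if y = z then A y ι κ else 0 := by
    intro y
    simp only [twistedTwoPoint_zero_apply, sub_eq_zero, mul_ite, mul_one, mul_zero]
    by_cases h : z = y
    · subst h
      simp [Finset.sum_ite_eq']
    · simp [h, Ne.symm h]
  simp_rw [inner]
  exact Finset.sum_ite_eq' (box 2 m) z _

/-! ### The three pieces of the expansion -/

/-- **First-step piece**: `Σ_{ω ∈ 𝒲ᴺᴮ_{1+l}(0,z)_{ι,κ}} e^{-iσW_ι(ω)} K[1,1+l](ω)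
= Σ_λ T_σ(ι,λ) G^σ_l(z - e_λ)(λ,κ)` (`l ≥ 1`): split after the first step; the first piece is the
one-step matrix `G^σ_1 = D` (`twistedTwoPoint_one_apply`).
[cite: Slade2006LaceExpansion, §3.2 (first term of (3.14))] -/
theorem sum_nbWalkFun_K_one (σ : ℝ) {l : ℕ} (hl : 1 ≤ l) (z : Site 2) (ι κ : Fin 4) :
    ∑ ω ∈ nbWalkFun ι κ (1 + l) z,
        twistedWeight σ ι (1 + l) ω * ((K (interaction 1 ω) 1 (1 + l) : ℝ) : ℂ) =
      ∑ lam : Fin 4, twistedStepMatrix σ ι lam * twistedTwoPoint σ l (z - stepDir lam) lam κ := by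
  have h := sum_nbWalkFun_mul_K σ le_rfl hl z ι κ (fun ω => K (interaction 1 ω) 0 1)
    (fun v ω₁ ω₂ => K_glue_of_le 1 v ω₁ ω₂ le_rfl)
  have hins : ∀ ω ∈ nbWalkFun ι κ (1 + l) z,
      twistedWeight σ ι (1 + l) ω * ((K (interaction 1 ω) 1 (1 + l) : ℝ) : ℂ) =
        twistedWeight σ ι (1 + l) ω *
          ((K (interaction 1 ω) 0 1 * K (interaction 1 ω) 1 (1 + l) : ℝ) : ℂ) := by
    intro ω hω
    rw [K_zero_one_eq_one (by omega) (nbWalkFun_subset ι κ _ z hω), one_mul]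
  rw [Finset.sum_congr rfl hins, h]
  simp_rw [← twistedTwoPoint_one_eq_sum, twistedTwoPoint_one_apply, ite_mul, zero_mul]
  rw [Finset.sum_comm]
  refine Finset.sum_congr rfl fun lam _ => ?_
  rw [Finset.sum_ite_eq' (box 2 1) (stepDir lam), if_pos (stepDir_mem_box_one lam)]

/-- **Middle pieces**: `Σ_{ω ∈ 𝒲ᴺᴮ_{m+l}(0,z)_{ι,κ}} e^{-iσW_ι(ω)} J[0,m](ω) K[m,m+l](ω)
= Σ_{y ∈ {-m,…,m}²} (Π^σ_m(y) G^σ_l(z - y))(ι,κ)` for `m, l ≥ 1`.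
[cite: Slade2006LaceExpansion, §3.2 (the terms `π_m ∗ c_{n-m}` of (3.14))] -/
theorem sum_nbWalkFun_J_mul_K (σ : ℝ) {m l : ℕ} (hm : 1 ≤ m) (hl : 1 ≤ l) (z : Site 2)
    (ι κ : Fin 4) :
    ∑ ω ∈ nbWalkFun ι κ (m + l) z, twistedWeight σ ι (m + l) ω *
        ((J (interaction 1 ω) 0 m * K (interaction 1 ω) m (m + l) : ℝ) : ℂ) =
      ∑ y ∈ box 2 m, ∑ lam : Fin 4,
        twistedLaceCoefficient σ m y ι lam * twistedTwoPoint σ l (z - y) lam κ := by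
  rw [sum_nbWalkFun_mul_K σ hm hl z ι κ (fun ω => J (interaction 1 ω) 0 m)
    (fun v ω₁ ω₂ => J_glue_of_le 1 m v ω₁ ω₂)]
  simp_rw [twistedLaceCoefficient_apply]

/-- **Last piece** (`m = n + 1`, no continuation): `Σ_{ω ∈ 𝒲ᴺᴮ_m(0,z)_{ι,κ}} e^{-iσW} J[0,m] K[m,m]
= Π^σ_m(z)(ι,κ) = Σ_y (Π^σ_m(y) G^σ_0(z - y))(ι,κ)`.
[cite: Slade2006LaceExpansion, §3.2 (the term `m = n` of (3.14): `π_n ∗ c₀ = π_n`)] -/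
theorem sum_nbWalkFun_J_self (σ : ℝ) (m : ℕ) (z : Site 2) (ι κ : Fin 4) :
    ∑ ω ∈ nbWalkFun ι κ m z, twistedWeight σ ι m ω *
        ((J (interaction 1 ω) 0 m * K (interaction 1 ω) m m : ℝ) : ℂ) =
      ∑ y ∈ box 2 m, ∑ lam : Fin 4,
        twistedLaceCoefficient σ m y ι lam * twistedTwoPoint σ 0 (z - y) lam κ := by
  rw [sum_mul_twistedTwoPoint_zero]
  simp_rw [K_self_eq_one, mul_one]
  rw [← twistedLaceCoefficient_apply]
  by_cases hz : z ∈ box 2 m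
  · rw [if_pos hz]
  · rw [if_neg hz, twistedLaceCoefficient_eq_zero_of_notMem_box σ hz, Matrix.zero_apply]

/-! ### The twisted lace expansion -/

/-- **The twisted lace expansion (twisted NoBLE identity)**, entrywise: for all `n ≥ 0`,
`G^σ_{n+1}(z)(ι,κ) = Σ_λ T_σ(ι,λ) G^σ_n(z - e_λ)(λ,κ)
  + Σ_{m=1}^{n+1} Σ_{y ∈ {-m,…,m}²} Σ_λ Π^σ_m(y)(ι,λ) G^σ_{n+1-m}(z - y)(λ,κ)` —
Slade's (3.14) for the complex memory-2 weight, in the matrix bookkeeping of the non-backtracking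
lace expansion (earlier piece on the left). Proof: (3.12), Lemma 3.4 on `[0, n+1]`
(`K_eq_K_succ_add_sum`) and the three pieces above; `n = 0` is `G^σ_1 = D`.
[cite: Slade2006LaceExpansion, eq. (3.14)] -/
theorem twistedTwoPoint_succ_apply (σ : ℝ) (n : ℕ) (z : Site 2) (ι κ : Fin 4) :
    twistedTwoPoint σ (n + 1) z ι κ =
      ∑ lam : Fin 4, twistedStepMatrix σ ι lam * twistedTwoPoint σ n (z - stepDir lam) lam κ +
        ∑ m ∈ Finset.Icc 1 (n + 1), ∑ y ∈ box 2 m, ∑ lam : Fin 4,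
          twistedLaceCoefficient σ m y ι lam * twistedTwoPoint σ (n + 1 - m) (z - y) lam κ := by
  cases n with
  | zero =>
    -- `G_1 = D`, `Π_1 = 0`
    rw [zero_add, Finset.Icc_self, Finset.sum_singleton, Nat.sub_self]
    simp only [twistedLaceCoefficient_one, Matrix.zero_apply, Finset.sum_const_zero,
      add_zero, twistedTwoPoint_one_apply, twistedTwoPoint_zero_apply, sub_eq_zero, mul_ite,
      mul_one, mul_zero, ite_self]
    rw [Finset.sum_eq_single κ]
    · by_cases hz : z = stepDir κ
      · rw [if_pos hz, if_pos ⟨hz, rfl⟩]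
      · rw [if_neg hz, if_neg (fun h => hz h.1)]
    · intro lam _ hne
      rw [if_neg (fun h => hne h.2)]
    · intro h; exact absurd (Finset.mem_univ κ) h
  | succ n =>
    -- (3.12) and Lemma 3.4 on `[0, n+2]`
    rw [twistedTwoPoint, Matrix.of_apply, if_neg (Nat.succ_ne_zero _)]
    have hIoc : Finset.Ioc 0 (n + 1 + 1) = Finset.Icc 1 (n + 1 + 1) := by
      ext j
      rw [Finset.mem_Ioc, Finset.mem_Icc]
      omega
    have h34 : ∀ ω : ℕ → Site 2,
        twistedWeight σ ι (n + 1 + 1) ω * ((K (interaction 1 ω) 0 (n + 1 + 1) : ℝ) : ℂ) =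
          twistedWeight σ ι (n + 1 + 1) ω * ((K (interaction 1 ω) 1 (n + 1 + 1) : ℝ) : ℂ) +
            ∑ j ∈ Finset.Icc 1 (n + 1 + 1), twistedWeight σ ι (n + 1 + 1) ω *
              ((J (interaction 1 ω) 0 j * K (interaction 1 ω) j (n + 1 + 1) : ℝ) : ℂ) := by
      intro ω
      rw [K_eq_K_succ_add_sum _ (Nat.succ_pos _), hIoc]
      push_cast
      rw [mul_add, Finset.mul_sum]
    rw [Finset.sum_congr rfl fun ω _ => h34 ω, Finset.sum_add_distrib, Finset.sum_comm]
    congr 1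
    · -- the first-step piece
      have hB := sum_nbWalkFun_K_one σ (l := n + 1) (by omega) z ι κ
      rwa [show 1 + (n + 1) = n + 1 + 1 by ring] at hB
    · rw [Finset.sum_Icc_succ_top (a := 1) (b := n + 1) (by omega),
        Finset.sum_Icc_succ_top (a := 1) (b := n + 1) (by omega)]
      refine congrArg₂ (· + ·) (Finset.sum_congr rfl fun j hj => ?_) ?_
      · -- the middle pieces `1 ≤ j ≤ n + 1`
        rw [Finset.mem_Icc] at hj
        obtain ⟨l, hl⟩ : ∃ l, n + 1 + 1 = j + l := ⟨n + 1 + 1 - j, by omega⟩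
        rw [show n + 1 + 1 - j = l by omega, hl]
        exact sum_nbWalkFun_J_mul_K σ hj.1 (by omega) z ι κ
      · -- the last piece `j = n + 2`
        rw [Nat.sub_self]
        exact sum_nbWalkFun_J_self σ (n + 1 + 1) z ι κ

/-- **The twisted lace expansion (twisted NoBLE identity)**, matrix form: for all `n ≥ 0` and `z`,
`G^σ_{n+1}(z) = [Σ_λ T_σ(ι,λ) G^σ_n(z - e_λ)(λ,κ)]_{ι,κ} + Σ_{m=1}^{n+1} Σ_{y ∈ {-m,…,m}²} Π^σ_m(y) G^σ_{n+1-m}(z - y)`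
(matrix products; as formal power series in the length, `Ĝ = E + x D ⋆ Ĝ + Π̂^σ ⋆ Ĝ`).
[cite: Slade2006LaceExpansion, eq. (3.14)] -/
theorem twistedTwoPoint_succ (σ : ℝ) (n : ℕ) (z : Site 2) :
    twistedTwoPoint σ (n + 1) z =
      Matrix.of (fun ι κ => ∑ lam : Fin 4,
          twistedStepMatrix σ ι lam * twistedTwoPoint σ n (z - stepDir lam) lam κ) +
        ∑ m ∈ Finset.Icc 1 (n + 1), ∑ y ∈ box 2 m,
          twistedLaceCoefficient σ m y * twistedTwoPoint σ (n + 1 - m) (z - y) := by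
  ext ι κ
  rw [twistedTwoPoint_succ_apply, Matrix.add_apply, Matrix.of_apply]
  simp only [Matrix.sum_apply, Matrix.mul_apply]

/-! ### The twisted two-point matrix as a sum over self-avoiding Mathlib walks -/

/-- The support of a walk is the list of its vertices `getVert 0, …, getVert length`. [folklore] -/
theorem support_eq_map_getVert {V : Type*} {G : SimpleGraph V} {u v : V} :
    ∀ (p : G.Walk u v), p.support = (List.range (p.length + 1)).map p.getVert
  | .nil => by simp
  | .cons h q => by
    rw [SimpleGraph.Walk.support_cons, SimpleGraph.Walk.length_cons, List.range_succ_eq_map,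
      List.map_cons, List.map_map, SimpleGraph.Walk.getVert_zero, support_eq_map_getVert q]
    rfl

/-- **`G^σ_n` over Mathlib walks** (`n ≥ 1`): `G^σ_n(z)(ι,κ)` is the sum, over the self-avoiding
`n`-step walks `p : 0 → z` of `ℤ²` (`finsetWalkLength`, `IsPath`), of `e^{-iσ W}`, `W` the winding
of `-e_ι :: p.support`, the walks whose first step reverses `e_ι` or whose last step is not `e_κ`
contributing `0` — verbatim the two-point matrix `G` of the items of route `SAWTwistedSelfEnergy`
(`walkFun` is the image of `finsetWalkLength` under `getVert`; `K[0,n] = 𝟙[IsPath]` by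
`walkWeight_one`). [folklore] -/
theorem twistedTwoPoint_eq_sum_paths (σ : ℝ) {n : ℕ} (hn : n ≠ 0) (z : Site 2) (ι κ : Fin 4) :
    twistedTwoPoint σ n z ι κ =
      ∑ p ∈ ((zdGraph 2).finsetWalkLength n (0 : Site 2) z).filter (fun p => p.IsPath),
        (if p.getVert 1 = -stepDir ι ∨ z - p.getVert (n - 1) ≠ stepDir κ then 0 else
          Complex.exp (-Complex.I * σ *
            (winding ((-Site.toComplex (stepDir ι)) :: (p.support.map Site.toComplex)) : ℝ))) := by
  classical
  rw [twistedTwoPoint, Matrix.of_apply, if_neg hn, nbWalkFun, Finset.sum_filter, walkFun,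
    Finset.sum_image (fun p _ q _ hpq => SimpleGraph.Walk.ext_getVert (congrFun hpq)),
    Finset.sum_filter]
  refine Finset.sum_congr rfl fun p hp => ?_
  rw [SimpleGraph.mem_finsetWalkLength_iff] at hp
  -- `K[0,n] = 𝟙[p is a path]`
  have hK : K (interaction 1 p.getVert) 0 n = if p.IsPath then 1 else 0 := by
    rw [← hp, ← walkWeight_eq_K, walkWeight_one]
  by_cases hpath : p.IsPath
  · rw [if_pos hpath, hK, if_pos hpath]
    have hinj := hpath.getVert_injOn
    have hlast : p.getVert n = z := p.getVert_of_length_le hp.le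
    -- the label constraints of a path reduce to the two endpoint conditions
    have hiff : IsNBLabelled ι κ n p.getVert ↔
        ¬ (p.getVert 1 = -stepDir ι ∨ z - p.getVert (n - 1) ≠ stepDir κ) := by
      rw [IsNBLabelled, not_or, not_not, hlast]
      constructor
      · rintro ⟨h1, -, h3⟩; exact ⟨h1, h3⟩
      · rintro ⟨h1, h3⟩
        refine ⟨h1, fun i hi => ?_, h3⟩
        rw [Finset.mem_range] at hi
        intro h
        have := hinj (by simp; omega) (by simp; omega) h
        omega
    by_cases hbad : p.getVert 1 = -stepDir ι ∨ z - p.getVert (n - 1) ≠ stepDir κ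
    · rw [if_pos hbad, if_neg (fun h => (hiff.1 h) hbad)]
    · rw [if_neg hbad, if_pos (hiff.2 hbad), twistedWeight, twistedWinding, LaceExpansion.polyline,
        support_eq_map_getVert, hp, List.map_map]
      push_cast
      rw [mul_one]
      rfl
  · rw [if_neg hpath, hK, if_neg hpath]
    simp

end Literature.Probability.RandomPlanarGeometry.LaceExpansion
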